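import Literature.Analysis.FluidPDE.AxisymNoSwirlVorticity
import Literature.Analysis.FluidPDE.MildSolutionProofs
import HarnessLib

/-!
# The scalar equation for `ω_θ / r` (KNSS 2009, (5.10)) from the vorticity equation

Analysis/FluidPDE support file (all results proved) on the decomposition path of the named fact
`Literature.Analysis.FluidPDE.KNSS2009_liouville_axisymmetric_no_swirl` (Koch–Nadirashvili–
Seregin–Šverák, Acta Math. 203 (2009) = arXiv:0709.3599, Theorem 5.2). For an axisymmetric
swirl-free flow KNSS pass from the vorticity equation `ωₜ + (u·∇)ω − (ω·∇)u = Δω` to the scalar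
equation (5.10) for `f = ω_θ / r`,
`fₜ + u_r f_{,r} + u_z f_{,z} = Δf + (2/r) f_{,r}`,
"nothing but the `θ`-component of the equation for `ω`, [obtained] by simple calculation" (p. 9).
This file performs that calculation in Cartesian form. With the infinitesimal rotation
`Jx = (−x₁, x₀, 0)` (`Fluid.rotGen`) and `ω = f · J` (`AxisymNoSwirlVorticity`):

* `fderiv_smul_rotGen_apply`: `D(fJ)(x) h = (Df(x) h) Jx + f(x) Jh`;
* `laplacian_smul_rotGen`: `Δ(fJ)(x) = (Δf)(x) Jx + 2 J(∇f(x))` (Leibniz rule, `ΔJ = 0`);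
* `vorticity_terms_eq_of_smul_rotGen`: if moreover the drift `c = u(x)` satisfies the
  infinitesimal axisymmetry `DU(x)[Jx] = J c`, then
  `Δω − Dω[c] + DU[ω] = (Δf − Df[c]) Jx + 2 J(∇f)` at `x` — the stretching term
  `DU[ω] = f DU[Jx] = f Jc` cancels the term `f Jc` of `Dω[c]`;
* pairing with `Jx` (`⟪Ja, Jc⟫ = a₀c₀ + a₁c₁`, `|Jx|² = r²`):
  `⟪Δω − Dω[c] + DU[ω], Jx⟫ = r² (Δf − Df[c]) + 2 (x₀∂₀f + x₁∂₁f)`, i.e. off the axis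
  `Δf − Df[c] + (2/r) ∂ᵣf` times `r²` — KNSS's (5.10) with `(u·∇)f = Df[u]` and
  `(2/r)∂ᵣ f = 2(x₀∂₀f + x₁∂₁f)/r²`;
* `integral_scalarEq_of_vorticityEq`: the time-integrated form consumed downstream — from the
  integrated vorticity equation of `KNSS2009_regularity_boundedWeak_ancient` at a point `x`,
  the structure `curl (U τ) = f τ · J` and the infinitesimal axisymmetry of the drift for a.e. `τ`,
  one gets `r² (f(t,x) − f(s,x)) = ∫ₛᵗ (r² (Δf − Df[U + b]) + 2(x₀∂₀f + x₁∂₁f)) dτ`.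

## References

* G. Koch, N. Nadirashvili, G. Seregin, V. Šverák, *Liouville theorems for the Navier–Stokes
  equations and applications*, Acta Math. 203 (2009) = arXiv:0709.3599, §5, (5.10)–(5.12)
  (p. 9) and the proof of Theorem 5.2 (p. 10). [KochNadirashviliSereginSverak2009]
-/

noncomputable section

open Set Function Filter MeasureTheory Topology WithLp
open scoped RealInnerProductSpace Laplacian ContDiff

namespace Literature.Analysis.FluidPDE

/-! ### Algebra of the infinitesimal rotation -/

section RotGen

/-- `⟪Ja, Jc⟫ = a₀c₀ + a₁c₁` (`J` is an isometry of the horizontal plane and kills `e_z`). [folklore] -/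
theorem inner_rotGen_rotGen (a c : EuclideanSpace ℝ (Fin 3)) :
    ⟪rotGen a, rotGen c⟫ = a 0 * c 0 + a 1 * c 1 := by
  rw [inner_rotGen_left]
  simp only [rotGen_apply_one, rotGen_apply_zero]
  ring

/-- `|Jx|² = x₀² + x₁² = r²`. [folklore] -/
theorem inner_rotGen_self_eq (x : EuclideanSpace ℝ (Fin 3)) :
    ⟪rotGen x, rotGen x⟫ = x 0 ^ 2 + x 1 ^ 2 := by
  rw [inner_rotGen_rotGen]; ring

/-- `⟪J(∇f(x)), Jx⟫ = x₀ ∂₀f(x) + x₁ ∂₁f(x)` (`= r ∂ᵣ f`). [folklore] -/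
theorem inner_rotGen_gradient_rotGen (f : EuclideanSpace ℝ (Fin 3) → ℝ) (x : EuclideanSpace ℝ (Fin 3)) :
    ⟪rotGen (gradient f x), rotGen x⟫ =
      x 0 * fderiv ℝ f x (EuclideanSpace.single 0 1) + x 1 * fderiv ℝ f x (EuclideanSpace.single 1 1) := by
  rw [inner_rotGen_rotGen]
  have h : ∀ i : Fin 3, gradient f x i = fderiv ℝ f x (EuclideanSpace.single i 1) := fun i => by
    rw [← inner_gradient_left (𝕜 := ℝ), real_inner_comm, EuclideanSpace.inner_single_left, map_one,
      one_mul]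
  rw [h 0, h 1]; ring

/-- The derivative of the (linear) infinitesimal rotation is itself: `D J (x) = J`. [folklore] -/
theorem fderiv_rotGen (x : EuclideanSpace ℝ (Fin 3)) : fderiv ℝ rotGen x = rotGenL :=
  (hasFDerivAt_rotGen x).fderiv

/-- `J` is smooth. [folklore] -/
theorem contDiff_rotGen {n : WithTop ℕ∞} : ContDiff ℝ n rotGen := by
  have h : rotGen = fun x => rotGenL x := funext fun x => (rotGenL_apply x).symm
  rw [h]; exact rotGenL.contDiff

/-- The Laplacian of the linear map `J` vanishes. [folklore] -/
theorem laplacian_rotGen (x : EuclideanSpace ℝ (Fin 3)) : (Δ rotGen) x = 0 := by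
  rw [laplacian_eq_sum_fderiv_fderiv (stdOrthonormalBasis ℝ (EuclideanSpace ℝ (Fin 3)))
    (contDiff_rotGen (n := 2)) x]
  refine Finset.sum_eq_zero fun i _ => ?_
  have h : (fun y => fderiv ℝ rotGen y (stdOrthonormalBasis ℝ (EuclideanSpace ℝ (Fin 3)) i)) =
      fun _ => rotGenL (stdOrthonormalBasis ℝ (EuclideanSpace ℝ (Fin 3)) i) := by
    funext y; rw [fderiv_rotGen]
  rw [h, fderiv_fun_const, Pi.zero_apply]
  rfl

end RotGen

/-! ### Calculus of `f · J` -/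

section SmulRotGen

variable {f : EuclideanSpace ℝ (Fin 3) → ℝ}

/-- **`D(fJ)(x) h = (Df(x) h) Jx + f(x) Jh`**. [folklore] -/
theorem fderiv_smul_rotGen_apply {x : EuclideanSpace ℝ (Fin 3)} (hf : DifferentiableAt ℝ f x)
    (h : EuclideanSpace ℝ (Fin 3)) :
    fderiv ℝ (fun y => f y • rotGen y) x h = (fderiv ℝ f x h) • rotGen x + f x • rotGen h := by
  rw [fderiv_fun_smul hf (hasFDerivAt_rotGen x).differentiableAt, fderiv_rotGen,
    _root_.add_apply, _root_.smul_apply, rotGenL_apply,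
    ContinuousLinearMap.smulRight_apply, add_comm]

/-- **`Δ(fJ)(x) = (Δf)(x) Jx + 2 J(∇f(x))`** for `f ∈ C²` (Leibniz rule for the Laplacian of a
scalar multiple, `Fluid.laplacian_smul_apply`, with `ΔJ = 0`, `∂ᵢJ = J eᵢ` and
`Σᵢ (∂ᵢf) J eᵢ = J(∇f)`). [folklore] -/
theorem laplacian_smul_rotGen (hf : ContDiff ℝ 2 f) (x : EuclideanSpace ℝ (Fin 3)) :
    (Δ (fun y => f y • rotGen y)) x = ((Δ f) x) • rotGen x + (2 : ℝ) • rotGen (gradient f x) := by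
  rw [laplacian_smul_apply hf (contDiff_rotGen (n := 2)) x, laplacian_rotGen, smul_zero, zero_add,
    add_comm]
  -- `Σᵢ (∂ᵢf) • J(bᵢ) = J (Σᵢ (∂ᵢf) • bᵢ) = J (∇f)`
  have h1 : ∀ v, fderiv ℝ rotGen x v = rotGen v := fun v => by rw [fderiv_rotGen, rotGenL_apply]
  have hsum : ∑ i, (fderiv ℝ f x (stdOrthonormalBasis ℝ (EuclideanSpace ℝ (Fin 3)) i)) •
      fderiv ℝ rotGen x (stdOrthonormalBasis ℝ (EuclideanSpace ℝ (Fin 3)) i) = rotGen (gradient f x) := by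
    simp_rw [h1]
    have hg : gradient f x =
        ∑ i, (fderiv ℝ f x (stdOrthonormalBasis ℝ (EuclideanSpace ℝ (Fin 3)) i)) •
          stdOrthonormalBasis ℝ (EuclideanSpace ℝ (Fin 3)) i := by
      conv_lhs => rw [← (stdOrthonormalBasis ℝ (EuclideanSpace ℝ (Fin 3))).sum_repr' (gradient f x)]
      refine Finset.sum_congr rfl fun i _ => ?_
      rw [real_inner_comm, inner_gradient_left]
    rw [hg, ← rotGenL_apply, map_sum]
    refine Finset.sum_congr rfl fun i _ => ?_
    rw [map_smul, rotGenL_apply]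
  rw [hsum]

/-- **The vorticity-equation terms for `ω = fJ` with an axisymmetric drift.** Let `U ∈ C¹` near
`x` with `ω = curl U = f · J` (as functions, `f ∈ C²`), and let the drift `c` satisfy the
infinitesimal axisymmetry `DU(x)[Jx] = Jc` (this is `Du(x)[Jx] = J u(x)` for the axisymmetric
velocity `u = U + b(t)`, `c = u(x)`, `Du = DU`). Then at `x`:
`Δω − Dω[c] + DU[ω] = (Δf − Df[c]) · Jx + 2 J(∇f)` — the stretching term `DU[ω] = f Jc` cancels
the rotation part `f Jc` of the transport term (KNSS 2009, p. 9: the `θ`-component of the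
vorticity equation). [cite: KochNadirashviliSereginSverak2009, §5 p. 9 ((5.10) from the θ-component of the vorticity equation)] -/
theorem vorticity_terms_eq_of_smul_rotGen {U : EuclideanSpace ℝ (Fin 3) → EuclideanSpace ℝ (Fin 3)}
    (hf : ContDiff ℝ 2 f) (hω : curl U = fun y => f y • rotGen y) {x c : EuclideanSpace ℝ (Fin 3)}
    (hax : fderiv ℝ U x (rotGen x) = rotGen c) :
    (Δ (curl U)) x - fderiv ℝ (curl U) x c + fderiv ℝ U x (curl U x) =
      ((Δ f) x - fderiv ℝ f x c) • rotGen x + (2 : ℝ) • rotGen (gradient f x) := by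
  have hfd : DifferentiableAt ℝ f x := (hf.differentiable (by norm_num)) x
  rw [hω, laplacian_smul_rotGen hf x, fderiv_smul_rotGen_apply hfd c]
  simp only [map_smul, hax, sub_smul]
  abel

/-- **The scalar combination, paired with `Jx`**: under the hypotheses of
`vorticity_terms_eq_of_smul_rotGen`,
`⟪Δω − Dω[c] + DU[ω], Jx⟫ = r² (Δf − Df[c]) + 2 (x₀∂₀f + x₁∂₁f)` with `r² = x₀² + x₁²`; off the
axis this is `r²` times `Δf − Df[c] + (2/r)∂ᵣf`, the spatial part of KNSS's (5.10). [cite: KochNadirashviliSereginSverak2009, §5 (5.10) p. 9] -/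
theorem inner_vorticity_terms_rotGen_eq {U : EuclideanSpace ℝ (Fin 3) → EuclideanSpace ℝ (Fin 3)}
    (hf : ContDiff ℝ 2 f) (hω : curl U = fun y => f y • rotGen y) {x c : EuclideanSpace ℝ (Fin 3)}
    (hax : fderiv ℝ U x (rotGen x) = rotGen c) :
    ⟪(Δ (curl U)) x - fderiv ℝ (curl U) x c + fderiv ℝ U x (curl U x), rotGen x⟫ =
      (x 0 ^ 2 + x 1 ^ 2) * ((Δ f) x - fderiv ℝ f x c) +
        2 * (x 0 * fderiv ℝ f x (EuclideanSpace.single 0 1) +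
          x 1 * fderiv ℝ f x (EuclideanSpace.single 1 1)) := by
  rw [vorticity_terms_eq_of_smul_rotGen hf hω hax, inner_add_left, real_inner_smul_left,
    real_inner_smul_left, inner_rotGen_self_eq, inner_rotGen_gradient_rotGen]
  ring

end SmulRotGen

/-! ### The time-integrated scalar equation -/

section Integrated

/-- **The integrated scalar equation for `f = ω_θ / r` from the integrated vorticity equation**
(KNSS 2009, (5.10), p. 9, in the time-integrated Cartesian form used downstream). Let
`U : ℝ → ℝ³ → ℝ³`, `b : ℝ → ℝ³`, `s ≤ t` and `x ∈ ℝ³`. Assume: for every `τ ∈ [s, t]` the slice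
`U τ` is `C⁴`, its vorticity has `(curl U τ)₂ ≡ 0` and `x₀(curl U τ)₀ + x₁(curl U τ)₁ ≡ 0` (so that
`curl (U τ) = f τ · J` with the `C²` Hadamard quotient `f τ = hadamardQuotFst ((curl U τ) ·)₁`,
`AxisymNoSwirlVorticity`); for a.e. `τ ∈ (s, t)` the drift `U τ x + b τ` satisfies the
infinitesimal axisymmetry `DU(τ)(x)[Jx] = J(U τ x + b τ)`; the vorticity equation holds at `x`
in integrated form between `s` and `t` with an integrable integrand (the shape of
`KNSS2009_regularity_boundedWeak_ancient`). Then
`r² (f(t, x) − f(s, x)) = ∫ₛᵗ (r² (Δf − Df[U + b]) + 2 (x₀∂₀f + x₁∂₁f))(τ, x) dτ`,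
`r² = x₀² + x₁²`. [cite: KochNadirashviliSereginSverak2009, §5 (5.10) p. 9] -/
theorem integral_scalarEq_of_vorticityEq {U : ℝ → EuclideanSpace ℝ (Fin 3) → EuclideanSpace ℝ (Fin 3)}
    {b : ℝ → EuclideanSpace ℝ (Fin 3)} {s t : ℝ} (hst : s ≤ t) {x : EuclideanSpace ℝ (Fin 3)}
    (hU : ∀ τ ∈ Icc s t, ContDiff ℝ 4 (U τ))
    (h2 : ∀ τ ∈ Icc s t, ∀ y : EuclideanSpace ℝ (Fin 3), curl (U τ) y 2 = 0)
    (hb : ∀ τ ∈ Icc s t, ∀ y : EuclideanSpace ℝ (Fin 3),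
      y 0 * curl (U τ) y 0 + y 1 * curl (U τ) y 1 = 0)
    (hax : ∀ᵐ τ ∂(volume : Measure ℝ), τ ∈ Ioo s t →
      fderiv ℝ (U τ) x (rotGen x) = rotGen (U τ x + b τ))
    (hint : IntervalIntegrable (fun τ => (Δ (curl (U τ))) x - fderiv ℝ (curl (U τ)) x (U τ x + b τ) +
      fderiv ℝ (U τ) x (curl (U τ) x)) volume s t)
    (heq : curl (U t) x - curl (U s) x =
      ∫ τ in s..t, ((Δ (curl (U τ))) x - fderiv ℝ (curl (U τ)) x (U τ x + b τ) +
        fderiv ℝ (U τ) x (curl (U τ) x))) :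
    (x 0 ^ 2 + x 1 ^ 2) * (hadamardQuotFst (fun y => curl (U t) y 1) x -
        hadamardQuotFst (fun y => curl (U s) y 1) x) =
      ∫ τ in s..t, ((x 0 ^ 2 + x 1 ^ 2) *
          ((Δ (hadamardQuotFst fun y => curl (U τ) y 1)) x -
            fderiv ℝ (hadamardQuotFst fun y => curl (U τ) y 1) x (U τ x + b τ)) +
        2 * (x 0 * fderiv ℝ (hadamardQuotFst fun y => curl (U τ) y 1) x (EuclideanSpace.single 0 1) +
          x 1 * fderiv ℝ (hadamardQuotFst fun y => curl (U τ) y 1) x (EuclideanSpace.single 1 1))) := by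
  -- notation
  set f : ℝ → EuclideanSpace ℝ (Fin 3) → ℝ := fun τ => hadamardQuotFst fun y => curl (U τ) y 1 with hf
  -- structure and regularity on `[s, t]`
  have hstruct : ∀ τ ∈ Icc s t, curl (U τ) = fun y => f τ y • rotGen y := fun τ hτ =>
    funext fun y => eq_hadamardQuotFst_smul_rotGen
      (contDiff_curl (n := 1) ((hU τ hτ).of_le (by norm_num))) (h2 τ hτ) (hb τ hτ) y
  have hf2 : ∀ τ ∈ Icc s t, ContDiff ℝ 2 (f τ) := fun τ hτ =>
    contDiff_hadamardQuotFst_curl (n := 2) (by exact_mod_cast hU τ hτ)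
  -- pair the vector identity with `Jx`
  have hL : ⟪curl (U t) x - curl (U s) x, rotGen x⟫ = (x 0 ^ 2 + x 1 ^ 2) * (f t x - f s x) := by
    rw [hstruct t ⟨hst, le_rfl⟩, hstruct s ⟨le_rfl, hst⟩]
    simp only
    rw [← sub_smul, real_inner_smul_left, inner_rotGen_self_eq]
    ring
  have hR : ⟪∫ τ in s..t, ((Δ (curl (U τ))) x - fderiv ℝ (curl (U τ)) x (U τ x + b τ) +
        fderiv ℝ (U τ) x (curl (U τ) x)), rotGen x⟫ =
      ∫ τ in s..t, ⟪(Δ (curl (U τ))) x - fderiv ℝ (curl (U τ)) x (U τ x + b τ) +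
        fderiv ℝ (U τ) x (curl (U τ) x), rotGen x⟫ := by
    rw [real_inner_comm, ← innerSL_apply_apply (𝕜 := ℝ),
      ((innerSL ℝ (rotGen x)).intervalIntegral_comp_comm hint).symm]
    refine intervalIntegral.integral_congr fun τ _ => ?_
    rw [innerSL_apply_apply, real_inner_comm]
  rw [← hL, heq, hR]
  -- rewrite the integrand for a.e. `τ` (the endpoint `τ = t` is a null set)
  have hne : ∀ᵐ τ ∂(volume : Measure ℝ), τ ≠ t := by
    rw [ae_iff]
    simp
  refine intervalIntegral.integral_congr_ae ?_
  filter_upwards [hax, hne] with τ hτ hτne hτmem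
  rw [uIoc_of_le hst] at hτmem
  have hτI : τ ∈ Icc s t := ⟨hτmem.1.le, hτmem.2⟩
  have hτO : τ ∈ Ioo s t := ⟨hτmem.1, lt_of_le_of_ne hτmem.2 hτne⟩
  exact inner_vorticity_terms_rotGen_eq (hf2 τ hτI) (hstruct τ hτI) (hτ hτO)

end Integrated

end Literature.Analysis.FluidPDE

end
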